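import Mathlib.Algebra.MonoidAlgebra.Basic
import Mathlib.Analysis.SpecialFunctions.Trigonometric.DerivHyp
import Mathlib.Analysis.SpecialFunctions.Trigonometric.Series
import Mathlib.Analysis.SpecialFunctions.Pow.Real
import Mathlib.Data.Nat.Choose.Central
import Mathlib.Algebra.Order.BigOperators.Ring.Finset
import Mathlib.Algebra.BigOperators.Field
import HarnessLib

/-!
# The walk with uniform steps on `{-L, …, L}`: local limit and Gaussian upper bounds, uniformly
# in the range `L`

Elementary heat-kernel upper bounds for the one-dimensional random walk whose step is uniformly
distributed on the `2L+1` integers `{-L, …, L}`, with constants independent of `L ≥ 1` and of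
the number of steps `n ≥ 1`:

* `coeff_uniformStep_pow_le_local` — the local (concentration) bound
  `P(S_n = y) ≤ 2 / (L √n)`;
* `tail_uniformStep_pow_le` — the sub-Gaussian tail `P(|S_n| ≥ r) ≤ 2 exp(-r²/(2nL²))`
  (Chernoff–Hoeffding, from `E e^{tX} ≤ cosh(tL) ≤ e^{t²L²/2}`);
* `coeff_uniformStep_pow_le_gauss` — the pointwise Gaussian bound
  `P(S_n = y) ≤ (20 / (L√n)) exp(-y²/(8nL²))`.

These are the one-dimensional inputs of the `L`-uniform bound
`S_1(x) ≤ δ_{0,x} + O(L^{-2}) ⟦x⟧^{-(d-2)}` on the Green function of the spread-out random walk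
on `ℤ^d` (Liu–Slade 2026, Proposition 1.2, (1.10); Hara–van der Hofstad–Slade 2003,
Prop. 1.7), proved in
`Literature/Barriers/CriticalPhenomena/LaceExpansionIsingDeconvolutionProofs.lean` by tensorisation
over the coordinates.

## Method

Distributions of finitely supported walks on `ℤ` are elements of the group algebra
`ℝ[ℤ] = AddMonoidAlgebra ℝ ℤ`, whose multiplication is convolution, so that the `n`-step
distribution is the `n`-th power `(uniformStep L)^n` and the binomial theorem is available.
The local bound is proved by a randomisation argument, not by Fourier analysis: the uniform
distribution on `{-L,…,L}` is the mixture
`u = (2L+1)⁻¹ δ_L + (2L/(2L+1)) · (z * b)`, `z` uniform on `{-L,…,-1}`, `b = ½(δ_0 + δ_L)`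
(`uniformStep_eq`); expanding `uⁿ` binomially, a term with `k ≥ 1` factors `z * b` is
`zᵏ * bᵏ = 2⁻ᵏ Σ_j C(k,j) zᵏ(· - jL)`, and `zᵏ` is exactly equidistributed modulo `L`
(`sum_coeff_mul_zStep_le`: `Σ_j zᵏ(w - jL) ≤ 1/L`), whence
`zᵏ * bᵏ ≤ (max_j C(k,j)/2ᵏ)/L ≤ 1/(L√(k+1))` by the central binomial bound
`C(2m,m)²(3m+1) ≤ 16ᵐ` (`centralBinom_sq_mul_le`);
averaging `1/√(K+1)` over `K ∼ Bin(n, 2L/(2L+1))` (Cauchy–Schwarz) gives `2/(L√n)`. The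
Gaussian bound follows from the local bound and the tail by splitting `u^{2m} = uᵐ * uᵐ`
according to which factor carries displacement `≥ |y|/2`.

## References

Folklore (local limit theorem and Hoeffding's inequality for bounded steps); the `L`-uniform
statement is the one-dimensional case of Hara–van der Hofstad–Slade, Ann. Probab. 31 (2003),
Prop. 1.7 / Liu–Slade, arXiv:2310.07640, Prop. 1.2 [LiuSlade2026]. Mathlib has the group
algebra, `Real.cosh_le_exp_half_sq`, `Nat.succ_mul_centralBinom_succ` and the finset
Cauchy–Schwarz inequality, all used here; it has no random-walk heat-kernel bounds.
-/

noncomputable section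

namespace Literature.Probability.LatticeModels

open Finset Real AddMonoidAlgebra
open scoped BigOperators

namespace UniformStep

/-! ## The group algebra `ℝ[ℤ]` as finitely supported (signed) measures on `ℤ` -/

/-- The total mass `Σ_m x(m)` of a finitely supported function `x : ℤ → ℝ` (an element of the
group algebra `ℝ[ℤ]`). [folklore] -/
def mass (x : ℝ[ℤ]) : ℝ := x.coeff.sum fun _ r => r

/-- Coefficientwise nonnegativity of an element of `ℝ[ℤ]` (a finitely supported measure).
[folklore] -/
def Nonneg (x : ℝ[ℤ]) : Prop := ∀ m, 0 ≤ x.coeff m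

/-- The character `m ↦ e^{tm}` of `ℤ`, as a monoid homomorphism on `Multiplicative ℤ`.
[folklore] -/
def expChar (t : ℝ) : Multiplicative ℤ →* ℝ where
  toFun m := Real.exp (t * ((Multiplicative.toAdd m : ℤ) : ℝ))
  map_one' := by simp
  map_mul' a b := by
    simp only [toAdd_mul, Int.cast_add, mul_add, Real.exp_add]

/-- The exponential moment functional `φ_t(x) = Σ_m x(m) e^{tm}`, an algebra homomorphism
`ℝ[ℤ] → ℝ` (so that `φ_t(xⁿ) = φ_t(x)ⁿ`: the moment generating function of a sum of
independent steps factorises). [folklore] -/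
def expMoment (t : ℝ) : ℝ[ℤ] →ₐ[ℝ] ℝ := AddMonoidAlgebra.lift ℝ ℝ ℤ (expChar t)

variable {x y : ℝ[ℤ]}

/-- `mass x = Σ_{m ∈ supp x} x(m)`. [folklore] -/
theorem mass_eq_sum (x : ℝ[ℤ]) : mass x = ∑ m ∈ x.coeff.support, x.coeff m := rfl

/-- `φ_t(x) = Σ_{m ∈ supp x} x(m) e^{tm}`. [folklore] -/
theorem expMoment_apply (t : ℝ) (x : ℝ[ℤ]) :
    expMoment t x = ∑ m ∈ x.coeff.support, x.coeff m * Real.exp (t * m) := by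
  rw [expMoment, AddMonoidAlgebra.lift_apply]
  simp only [Finsupp.sum, smul_eq_mul]
  rfl

/-- `φ_t(δ_m r) = r e^{tm}`. [folklore] -/
theorem expMoment_single (t : ℝ) (m : ℤ) (r : ℝ) :
    expMoment t (single m r) = r * Real.exp (t * m) := by
  rw [expMoment, AddMonoidAlgebra.lift_single, smul_eq_mul]
  rfl

/-- `φ_0 = mass`. [folklore] -/
theorem expMoment_zero (x : ℝ[ℤ]) : expMoment 0 x = mass x := by
  simp [expMoment_apply, mass_eq_sum]

/-- `mass (x * y) = mass x · mass y`. [folklore] -/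
theorem mass_mul (x y : ℝ[ℤ]) : mass (x * y) = mass x * mass y := by
  rw [← expMoment_zero, map_mul, expMoment_zero, expMoment_zero]

/-- `mass (xⁿ) = (mass x)ⁿ`. [folklore] -/
theorem mass_pow (x : ℝ[ℤ]) (n : ℕ) : mass (x ^ n) = mass x ^ n := by
  rw [← expMoment_zero, map_pow, expMoment_zero]

/-- `mass 1 = 1` (`1 = δ_0`). [folklore] -/
theorem mass_one : mass (1 : ℝ[ℤ]) = 1 := by
  rw [← expMoment_zero, map_one]

/-- `mass (c • x) = c · mass x`. [folklore] -/
theorem mass_smul (c : ℝ) (x : ℝ[ℤ]) : mass (c • x) = c * mass x := by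
  rw [← expMoment_zero, map_smul, smul_eq_mul, expMoment_zero]

/-- `mass (δ_m r) = r`. [folklore] -/
theorem mass_single (m : ℤ) (r : ℝ) : mass (single m r) = r := by
  rw [← expMoment_zero, expMoment_single, zero_mul, Real.exp_zero, mul_one]

/-- `mass` is additive over finite sums. [folklore] -/
theorem mass_sum {ι : Type*} (s : Finset ι) (f : ι → ℝ[ℤ]) :
    mass (∑ i ∈ s, f i) = ∑ i ∈ s, mass (f i) := by
  rw [← expMoment_zero, map_sum]
  exact Finset.sum_congr rfl fun i _ => expMoment_zero _

/-- The convolution formula `(x * y)(g) = Σ_{h ∈ supp y} x(g - h) y(h)`. [folklore] -/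
theorem coeff_mul_eq_sum (x y : ℝ[ℤ]) (g : ℤ) :
    (x * y).coeff g = ∑ h ∈ y.coeff.support, x.coeff (g - h) * y.coeff h := by
  rw [AddMonoidAlgebra.coeff_mul_apply_right]
  simp only [Finsupp.sum, ← sub_eq_add_neg]

/-- `(x * (c Σ_{m ∈ S} δ_m))(t) = c Σ_{v ∈ S} x(t - v)`. [folklore] -/
theorem coeff_mul_smul_sum_single (x : ℝ[ℤ]) (c : ℝ) (S : Finset ℤ) (t : ℤ) :
    (x * (c • ∑ m ∈ S, single m (1 : ℝ))).coeff t = c * ∑ v ∈ S, x.coeff (t - v) := by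
  rw [mul_smul_comm, coeff_smul, Finsupp.smul_apply, smul_eq_mul, Finset.mul_sum, coeff_sum,
    Finsupp.coe_finsetSum, Finset.sum_apply]
  congr 1
  refine Finset.sum_congr rfl fun v _ => ?_
  rw [AddMonoidAlgebra.coeff_mul_single_apply, mul_one, sub_eq_add_neg]

/-- `(Σ_{m ∈ S} δ_m)(y) = 1{y ∈ S}`. [folklore] -/
theorem coeff_sum_single (S : Finset ℤ) (y : ℤ) :
    (∑ m ∈ S, single m (1 : ℝ) : ℝ[ℤ]).coeff y = if y ∈ S then 1 else 0 := by
  rw [coeff_sum, Finsupp.coe_finsetSum, Finset.sum_apply]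
  simp only [coeff_single, Finsupp.single_apply]
  exact Finset.sum_ite_eq' S y fun _ => (1 : ℝ)

/-! ### Nonnegativity -/

/-- `1 = δ_0 ≥ 0`. [folklore] -/
theorem nonneg_one : Nonneg (1 : ℝ[ℤ]) := fun m => by
  rw [one_def, coeff_single, Finsupp.single_apply]
  split_ifs <;> norm_num

/-- `δ_m r ≥ 0` for `r ≥ 0`. [folklore] -/
theorem nonneg_single (m : ℤ) {r : ℝ} (hr : 0 ≤ r) : Nonneg (single m r) := fun n => by
  rw [coeff_single, Finsupp.single_apply]
  split_ifs
  · exact hr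
  · exact le_rfl

/-- Sums of nonnegative elements are nonnegative. [folklore] -/
theorem nonneg_sum {ι : Type*} (s : Finset ι) {f : ι → ℝ[ℤ]}
    (hf : ∀ i ∈ s, Nonneg (f i)) : Nonneg (∑ i ∈ s, f i) := fun m => by
  rw [coeff_sum, Finsupp.coe_finsetSum, Finset.sum_apply]
  exact Finset.sum_nonneg fun i hi => hf i hi m

/-- Nonnegativity is preserved by addition. [folklore] -/
theorem Nonneg.add (hx : Nonneg x) (hy : Nonneg y) : Nonneg (x + y) := fun m => by
  rw [coeff_add, Finsupp.add_apply]
  exact add_nonneg (hx m) (hy m)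

/-- Nonnegativity is preserved by nonnegative scalars. [folklore] -/
theorem Nonneg.smul (hx : Nonneg x) {c : ℝ} (hc : 0 ≤ c) : Nonneg (c • x) := fun m => by
  rw [coeff_smul, Finsupp.smul_apply, smul_eq_mul]
  exact mul_nonneg hc (hx m)

/-- Nonnegativity is preserved by convolution. [folklore] -/
theorem Nonneg.mul (hx : Nonneg x) (hy : Nonneg y) : Nonneg (x * y) := fun g => by
  rw [coeff_mul_eq_sum]
  exact Finset.sum_nonneg fun h _ => mul_nonneg (hx _) (hy _)

/-- Nonnegativity is preserved by convolution powers. [folklore] -/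
theorem Nonneg.pow (hx : Nonneg x) : ∀ n : ℕ, Nonneg (x ^ n)
  | 0 => by rw [pow_zero]; exact nonneg_one
  | n + 1 => by rw [pow_succ]; exact (hx.pow n).mul hx

/-- A nonnegative element has nonnegative mass. [folklore] -/
theorem Nonneg.mass_nonneg (hx : Nonneg x) : 0 ≤ mass x := by
  rw [mass_eq_sum]
  exact Finset.sum_nonneg fun m _ => hx m

/-- A nonnegative element has nonnegative exponential moments. [folklore] -/
theorem Nonneg.expMoment_nonneg (hx : Nonneg x) (t : ℝ) : 0 ≤ expMoment t x := by
  rw [expMoment_apply]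
  exact Finset.sum_nonneg fun m _ => mul_nonneg (hx m) (Real.exp_nonneg _)

/-- For `x ≥ 0`, the mass of any finite set of sites is at most the total mass. [folklore] -/
theorem Nonneg.sum_coeff_le_mass (hx : Nonneg x) (S : Finset ℤ) :
    ∑ c ∈ S, x.coeff c ≤ mass x := by
  calc ∑ c ∈ S, x.coeff c ≤ ∑ c ∈ S ∪ x.coeff.support, x.coeff c :=
        Finset.sum_le_sum_of_subset_of_nonneg subset_union_left fun c _ _ => hx c
    _ = ∑ c ∈ x.coeff.support, x.coeff c := by
        refine (Finset.sum_subset subset_union_right fun c _ hc => ?_).symm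
        simpa [Finsupp.mem_support_iff] using hc
    _ = mass x := (mass_eq_sum x).symm

/-- For `x ≥ 0`, each coefficient is at most the total mass. [folklore] -/
theorem Nonneg.coeff_le_mass (hx : Nonneg x) (c : ℤ) : x.coeff c ≤ mass x := by
  simpa using hx.sum_coeff_le_mass {c}

/-- For `x ≥ 0`: a sum of coefficients over `S` is at most the sum over any `T` containing the
part of `S` inside the support. [folklore] -/
theorem Nonneg.sum_coeff_le_sum_coeff (hx : Nonneg x) {S T : Finset ℤ}
    (h : ∀ v ∈ S, v ∈ x.coeff.support → v ∈ T) :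
    ∑ v ∈ S, x.coeff v ≤ ∑ v ∈ T, x.coeff v := by
  classical
  calc ∑ v ∈ S, x.coeff v = ∑ v ∈ S.filter (fun v => v ∈ x.coeff.support), x.coeff v := by
        rw [Finset.sum_filter]
        refine Finset.sum_congr rfl fun v _ => ?_
        split_ifs with hv
        · rfl
        · simpa [Finsupp.mem_support_iff] using hv
    _ ≤ ∑ v ∈ T, x.coeff v :=
        Finset.sum_le_sum_of_subset_of_nonneg
          (fun v hv => by
            rw [Finset.mem_filter] at hv
            exact h v hv.1 hv.2)
          fun v _ _ => hx v

/-- A uniform bound on `x` propagates through convolution with `y ≥ 0`: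
`(x * y)(g) ≤ (sup x) · mass y`. [folklore] -/
theorem coeff_mul_le_mul_mass (hy : Nonneg y) {A : ℝ} (hA : ∀ m, x.coeff m ≤ A) (g : ℤ) :
    (x * y).coeff g ≤ A * mass y := by
  rw [coeff_mul_eq_sum, mass_eq_sum, Finset.mul_sum]
  exact Finset.sum_le_sum fun h _ => mul_le_mul_of_nonneg_right (hA _) (hy h)

/-! ### Chernoff bounds -/

/-- **Markov's inequality for the upper tail**: for `x ≥ 0`, `t ≥ 0`,
`Σ_{m ≥ r} x(m) ≤ e^{-tr} φ_t(x)`. [folklore] -/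
theorem Nonneg.sum_filter_le_expMoment (hx : Nonneg x) {t : ℝ} (ht : 0 ≤ t) (r : ℝ) :
    ∑ m ∈ x.coeff.support with r ≤ ((m : ℤ) : ℝ), x.coeff m ≤
      Real.exp (-(t * r)) * expMoment t x := by
  rw [expMoment_apply, Finset.mul_sum]
  calc ∑ m ∈ x.coeff.support with r ≤ ((m : ℤ) : ℝ), x.coeff m
      ≤ ∑ m ∈ x.coeff.support with r ≤ ((m : ℤ) : ℝ),
          Real.exp (-(t * r)) * (x.coeff m * Real.exp (t * m)) := by
        refine Finset.sum_le_sum fun m hm => ?_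
        have hrm : r ≤ m := (Finset.mem_filter.1 hm).2
        have h1 : (1 : ℝ) ≤ Real.exp (-(t * r)) * Real.exp (t * m) := by
          rw [← Real.exp_add]
          exact Real.one_le_exp (by nlinarith)
        calc x.coeff m = x.coeff m * 1 := (mul_one _).symm
          _ ≤ x.coeff m * (Real.exp (-(t * r)) * Real.exp (t * m)) :=
              mul_le_mul_of_nonneg_left h1 (hx m)
          _ = _ := by ring
    _ ≤ ∑ m ∈ x.coeff.support, Real.exp (-(t * r)) * (x.coeff m * Real.exp (t * m)) :=
        Finset.sum_le_sum_of_subset_of_nonneg (Finset.filter_subset _ _) fun m _ _ =>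
          mul_nonneg (Real.exp_nonneg _) (mul_nonneg (hx m) (Real.exp_nonneg _))

/-- **Markov's inequality for the lower tail**: for `x ≥ 0`, `t ≥ 0`,
`Σ_{m ≤ -r} x(m) ≤ e^{-tr} φ_{-t}(x)`. [folklore] -/
theorem Nonneg.sum_filter_le_expMoment_neg (hx : Nonneg x) {t : ℝ} (ht : 0 ≤ t) (r : ℝ) :
    ∑ m ∈ x.coeff.support with ((m : ℤ) : ℝ) ≤ -r, x.coeff m ≤
      Real.exp (-(t * r)) * expMoment (-t) x := by
  rw [expMoment_apply, Finset.mul_sum]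
  calc ∑ m ∈ x.coeff.support with ((m : ℤ) : ℝ) ≤ -r, x.coeff m
      ≤ ∑ m ∈ x.coeff.support with ((m : ℤ) : ℝ) ≤ -r,
          Real.exp (-(t * r)) * (x.coeff m * Real.exp (-t * m)) := by
        refine Finset.sum_le_sum fun m hm => ?_
        have hrm : (m : ℝ) ≤ -r := (Finset.mem_filter.1 hm).2
        have h1 : (1 : ℝ) ≤ Real.exp (-(t * r)) * Real.exp (-t * m) := by
          rw [← Real.exp_add]
          exact Real.one_le_exp (by nlinarith)
        calc x.coeff m = x.coeff m * 1 := (mul_one _).symm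
          _ ≤ x.coeff m * (Real.exp (-(t * r)) * Real.exp (-t * m)) :=
              mul_le_mul_of_nonneg_left h1 (hx m)
          _ = _ := by ring
    _ ≤ ∑ m ∈ x.coeff.support, Real.exp (-(t * r)) * (x.coeff m * Real.exp (-t * m)) :=
        Finset.sum_le_sum_of_subset_of_nonneg (Finset.filter_subset _ _) fun m _ _ =>
          mul_nonneg (Real.exp_nonneg _) (mul_nonneg (hx m) (Real.exp_nonneg _))

/-- **Two-sided Chernoff bound**: for `x ≥ 0`, `t ≥ 0`,
`Σ_{|m| ≥ r} x(m) ≤ e^{-tr} (φ_t(x) + φ_{-t}(x))`. [folklore] -/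
theorem Nonneg.sum_filter_abs_le (hx : Nonneg x) {t : ℝ} (ht : 0 ≤ t) (r : ℝ) :
    ∑ m ∈ x.coeff.support with r ≤ |((m : ℤ) : ℝ)|, x.coeff m ≤
      Real.exp (-(t * r)) * (expMoment t x + expMoment (-t) x) := by
  classical
  set S := x.coeff.support
  set S₁ := S.filter (fun m : ℤ => r ≤ (m : ℝ))
  set S₂ := S.filter (fun m : ℤ => (m : ℝ) ≤ -r)
  have hsub : S.filter (fun m : ℤ => r ≤ |(m : ℝ)|) ⊆ S₁ ∪ S₂ := by
    intro m hm
    rw [Finset.mem_filter] at hm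
    rw [Finset.mem_union, Finset.mem_filter, Finset.mem_filter]
    rcases le_abs.1 hm.2 with h | h
    · exact Or.inl ⟨hm.1, h⟩
    · exact Or.inr ⟨hm.1, by linarith⟩
  calc ∑ m ∈ S with r ≤ |((m : ℤ) : ℝ)|, x.coeff m
      ≤ ∑ m ∈ S₁ ∪ S₂, x.coeff m := Finset.sum_le_sum_of_subset_of_nonneg hsub fun m _ _ => hx m
    _ ≤ ∑ m ∈ S₁, x.coeff m + ∑ m ∈ S₂, x.coeff m := by
        rw [← Finset.sum_union_inter]
        have : 0 ≤ ∑ m ∈ S₁ ∩ S₂, x.coeff m := Finset.sum_nonneg fun m _ => hx m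
        linarith
    _ ≤ Real.exp (-(t * r)) * expMoment t x + Real.exp (-(t * r)) * expMoment (-t) x :=
        add_le_add (hx.sum_filter_le_expMoment ht r) (hx.sum_filter_le_expMoment_neg ht r)
    _ = _ := by ring

/-! ## The uniform step distribution -/

/-- The uniform distribution on `{-L, …, L} ⊂ ℤ`: `u_L = (2L+1)⁻¹ Σ_{m=-L}^{L} δ_m`
(indexed by `Ico (-L) (L+1)`). [folklore] -/
def uniformStep (L : ℕ) : ℝ[ℤ] :=
  ((2 * L + 1 : ℝ))⁻¹ • ∑ m ∈ Ico (-(L : ℤ)) (L + 1), single m (1 : ℝ)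

variable {L : ℕ}

/-- `u_L(y) = (2L+1)⁻¹ 1{|y| ≤ L}`. [folklore] -/
theorem coeff_uniformStep (L : ℕ) (y : ℤ) :
    (uniformStep L).coeff y = if |y| ≤ L then ((2 * L + 1 : ℝ))⁻¹ else 0 := by
  rw [uniformStep, coeff_smul, Finsupp.smul_apply, coeff_sum_single, smul_eq_mul]
  have hiff : y ∈ Ico (-(L : ℤ)) (L + 1) ↔ |y| ≤ L := by rw [Finset.mem_Ico, abs_le]; omega
  by_cases h : |y| ≤ L
  · rw [if_pos h, if_pos (hiff.2 h), mul_one]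
  · rw [if_neg h, if_neg (fun h' => h (hiff.1 h')), mul_zero]

/-- `u_L ≥ 0`. [folklore] -/
theorem nonneg_uniformStep (L : ℕ) : Nonneg (uniformStep L) := fun y => by
  rw [coeff_uniformStep]
  split_ifs <;> positivity

/-- `u_L ≤ (2L+1)⁻¹` pointwise. [folklore] -/
theorem coeff_uniformStep_le (L : ℕ) (y : ℤ) :
    (uniformStep L).coeff y ≤ ((2 * L + 1 : ℝ))⁻¹ := by
  rw [coeff_uniformStep]
  split_ifs
  · exact le_rfl
  · positivity

/-- `mass u_L = 1`. [folklore] -/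
theorem mass_uniformStep (L : ℕ) : mass (uniformStep L) = 1 := by
  rw [uniformStep, mass_smul, mass_sum]
  simp only [mass_single, Finset.sum_const, nsmul_eq_mul, mul_one, Int.card_Ico]
  have : ((L : ℤ) + 1 - -(L : ℤ)).toNat = 2 * L + 1 := by omega
  rw [this]
  push_cast
  exact inv_mul_cancel₀ (by positivity)

/-- Convolution with the uniform step: `(x * u_L)(t) = (2L+1)⁻¹ Σ_{v=-L}^{L} x(t - v)`.
[folklore] -/
theorem coeff_mul_uniformStep (x : ℝ[ℤ]) (L : ℕ) (t : ℤ) :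
    (x * uniformStep L).coeff t =
      ((2 * L + 1 : ℝ))⁻¹ * ∑ v ∈ Ico (-(L : ℤ)) (L + 1), x.coeff (t - v) :=
  coeff_mul_smul_sum_single x _ _ t

/-- Convolution with the uniform step as a sum over the window around `t`:
`Σ_{m = t-L}^{t+L} x(m) u_L(t - m) = (x * u_L)(t)`. [folklore] -/
theorem sum_Icc_coeff_mul_coeff_uniformStep (x : ℝ[ℤ]) (L : ℕ) (t : ℤ) :
    ∑ m ∈ Icc (t - L) (t + L), x.coeff m * (uniformStep L).coeff (t - m) =
      (x * uniformStep L).coeff t := by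
  rw [coeff_mul_uniformStep, Finset.mul_sum]
  symm
  refine Finset.sum_equiv (Equiv.subLeft t) (fun v => ?_) (fun v hv => ?_)
  · rw [Equiv.subLeft_apply, Finset.mem_Ico, Finset.mem_Icc]
    omega
  · rw [Equiv.subLeft_apply, sub_sub_cancel, coeff_uniformStep, if_pos, mul_comm]
    rw [Finset.mem_Ico] at hv
    rw [abs_le]
    omega

/-- Averaging does not increase a uniform bound: `(x * u_L)(t) ≤ A` if `x ≤ A`. [folklore] -/
theorem coeff_mul_uniformStep_le {A : ℝ} (hA : ∀ m, x.coeff m ≤ A) (L : ℕ) (t : ℤ) :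
    (x * uniformStep L).coeff t ≤ A := by
  have h := coeff_mul_le_mul_mass (nonneg_uniformStep L) hA t
  rwa [mass_uniformStep, mul_one] at h

/-- Finite range: `u_Lⁿ(y) = 0` for `|y| > nL`. [folklore] -/
theorem coeff_uniformStep_pow_eq_zero (L : ℕ) :
    ∀ (n : ℕ) {y : ℤ}, (n : ℤ) * L < |y| → ((uniformStep L) ^ n).coeff y = 0
  | 0, y, hy => by
    rw [pow_zero, one_def, coeff_single, Finsupp.single_apply, if_neg]
    rintro rfl
    simp at hy
  | n + 1, y, hy => by
    rw [pow_succ, coeff_mul_uniformStep]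
    refine mul_eq_zero_of_right _ (Finset.sum_eq_zero fun v hv => ?_)
    rw [Finset.mem_Ico] at hv
    refine coeff_uniformStep_pow_eq_zero L n ?_
    have h1 : |y| ≤ |y - v| + |v| := by
      have := abs_add_le (y - v) v
      rwa [sub_add_cancel] at this
    have h2 : |v| ≤ L := abs_le.2 ⟨by omega, by omega⟩
    push_cast at hy
    linarith

/-- The moment generating function of the uniform step: `φ_t(u_L) ≤ cosh(tL) ≤ e^{t²L²/2}`
(Hoeffding's lemma for a symmetric bounded variable). [folklore] -/
theorem expMoment_uniformStep_le (L : ℕ) (t : ℝ) :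
    expMoment t (uniformStep L) ≤ Real.exp (t ^ 2 * L ^ 2 / 2) := by
  set S := Ico (-(L : ℤ)) (L + 1) with hS
  have hmem : ∀ m : ℤ, m ∈ S ↔ |m| ≤ L := fun m => by
    rw [hS, Finset.mem_Ico, abs_le]; omega
  have h1 : expMoment t (uniformStep L) =
      ((2 * L + 1 : ℝ))⁻¹ * ∑ m ∈ S, Real.exp (t * m) := by
    rw [uniformStep, map_smul, map_sum, smul_eq_mul]
    congr 1
    exact Finset.sum_congr rfl fun m _ => by rw [expMoment_single, one_mul]
  have hrefl : ∑ m ∈ S, Real.exp (t * m) = ∑ m ∈ S, Real.exp (-(t * m)) := by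
    refine Finset.sum_equiv (Equiv.neg ℤ) (fun m => ?_) (fun m _ => ?_)
    · rw [hmem, hmem, Equiv.neg_apply, abs_neg]
    · simp [mul_neg]
  have h2 : ∑ m ∈ S, Real.exp (t * m) = ∑ m ∈ S, Real.cosh (t * m) := by
    have : ∑ m ∈ S, Real.cosh (t * m) =
        ∑ m ∈ S, (Real.exp (t * m) + Real.exp (-(t * m))) / 2 :=
      Finset.sum_congr rfl fun m _ => Real.cosh_eq _
    rw [this, ← Finset.sum_div, Finset.sum_add_distrib, ← hrefl]
    ring
  have h3 : ∀ m ∈ S, Real.cosh (t * m) ≤ Real.cosh (t * L) := fun m hm => by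
    rw [Real.cosh_le_cosh, abs_mul, abs_mul]
    refine mul_le_mul_of_nonneg_left ?_ (abs_nonneg t)
    rw [Nat.abs_cast]
    exact_mod_cast (hmem m).1 hm
  have hcard : (S.card : ℝ) = 2 * L + 1 := by
    rw [hS, Int.card_Ico]
    have : ((L : ℤ) + 1 - -(L : ℤ)).toNat = 2 * L + 1 := by omega
    rw [this]; push_cast; ring
  have hpos : (0 : ℝ) < 2 * L + 1 := by positivity
  calc expMoment t (uniformStep L) = ((2 * L + 1 : ℝ))⁻¹ * ∑ m ∈ S, Real.cosh (t * m) := by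
        rw [h1, h2]
    _ ≤ ((2 * L + 1 : ℝ))⁻¹ * ∑ _m ∈ S, Real.cosh (t * L) :=
        mul_le_mul_of_nonneg_left (Finset.sum_le_sum h3) (by positivity)
    _ = Real.cosh (t * L) := by
        rw [Finset.sum_const, nsmul_eq_mul, hcard, ← mul_assoc, inv_mul_cancel₀ hpos.ne',
          one_mul]
    _ ≤ Real.exp ((t * L) ^ 2 / 2) := Real.cosh_le_exp_half_sq _
    _ = Real.exp (t ^ 2 * L ^ 2 / 2) := by ring_nf

/-- **Sub-Gaussian tail of the uniform-step walk** (Hoeffding): for `L, n ≥ 1` and `r ≥ 0`,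
`P(|S_n| ≥ r) = Σ_{|y| ≥ r} u_Lⁿ(y) ≤ 2 exp(-r²/(2nL²))`. [folklore] -/
theorem tail_uniformStep_pow_le (hL : 1 ≤ L) {n : ℕ} (hn : 1 ≤ n) {r : ℝ} (hr : 0 ≤ r) :
    ∑ y ∈ ((uniformStep L) ^ n).coeff.support with r ≤ |((y : ℤ) : ℝ)|,
        ((uniformStep L) ^ n).coeff y ≤ 2 * Real.exp (-(r ^ 2 / (2 * n * L ^ 2))) := by
  have hL' : (0 : ℝ) < L := by exact_mod_cast hL
  have hn' : (0 : ℝ) < n := by exact_mod_cast hn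
  set t := r / (n * L ^ 2) with ht
  have ht0 : 0 ≤ t := by positivity
  have hmom : ∀ s : ℝ,
      expMoment s ((uniformStep L) ^ n) ≤ Real.exp (n * (s ^ 2 * L ^ 2 / 2)) := by
    intro s
    rw [map_pow, Real.exp_nat_mul]
    exact pow_le_pow_left₀ ((nonneg_uniformStep L).expMoment_nonneg s)
      (expMoment_uniformStep_le L s) n
  have hexp : Real.exp (-(t * r)) * Real.exp (n * (t ^ 2 * L ^ 2 / 2)) =
      Real.exp (-(r ^ 2 / (2 * n * L ^ 2))) := by
    rw [← Real.exp_add]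
    congr 1
    rw [ht]
    field_simp
    ring
  calc ∑ y ∈ ((uniformStep L) ^ n).coeff.support with r ≤ |((y : ℤ) : ℝ)|,
        ((uniformStep L) ^ n).coeff y
      ≤ Real.exp (-(t * r)) *
          (expMoment t ((uniformStep L) ^ n) + expMoment (-t) ((uniformStep L) ^ n)) :=
        ((nonneg_uniformStep L).pow n).sum_filter_abs_le ht0 r
    _ ≤ Real.exp (-(t * r)) *
          (Real.exp (n * (t ^ 2 * L ^ 2 / 2)) + Real.exp (n * ((-t) ^ 2 * L ^ 2 / 2))) :=
        mul_le_mul_of_nonneg_left (add_le_add (hmom t) (hmom (-t))) (Real.exp_nonneg _)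
    _ = 2 * Real.exp (-(r ^ 2 / (2 * n * L ^ 2))) := by rw [neg_sq, ← hexp]; ring


/-! ## The local bound `P(S_n = y) ≤ 2/(L√n)` -/

/-- **Central binomial bound**: `C(2m,m)² (3m+1) ≤ 16ᵐ` (so `C(2m,m)/4ᵐ ≤ 1/√(3m+1)`), by
induction from `(m+1) C(2m+2,m+1) = 2(2m+1) C(2m,m)` and `(2m+1)²(3m+4) ≤ (2m+2)²(3m+1)`.
[folklore] -/
theorem centralBinom_sq_mul_le (m : ℕ) : m.centralBinom ^ 2 * (3 * m + 1) ≤ 16 ^ m := by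
  induction m with
  | zero => simp
  | succ m ih =>
    have h := Nat.succ_mul_centralBinom_succ m
    have hpos : 0 < (m + 1) ^ 2 * (3 * m + 1) := by positivity
    refine Nat.le_of_mul_le_mul_left ?_ hpos
    have hpoly : 4 * (2 * m + 1) ^ 2 * (3 * m + 4) ≤ 16 * (m + 1) ^ 2 * (3 * m + 1) := by
      have : 16 * (m + 1) ^ 2 * (3 * m + 1) = 4 * (2 * m + 1) ^ 2 * (3 * m + 4) + 4 * m := by
        ring
      omega
    calc (m + 1) ^ 2 * (3 * m + 1) * ((m + 1).centralBinom ^ 2 * (3 * (m + 1) + 1))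
        = ((m + 1) * (m + 1).centralBinom) ^ 2 * (3 * m + 4) * (3 * m + 1) := by ring
      _ = (2 * (2 * m + 1) * m.centralBinom) ^ 2 * (3 * m + 4) * (3 * m + 1) := by rw [h]
      _ = 4 * (2 * m + 1) ^ 2 * (3 * m + 4) * (m.centralBinom ^ 2 * (3 * m + 1)) := by ring
      _ ≤ 4 * (2 * m + 1) ^ 2 * (3 * m + 4) * 16 ^ m := Nat.mul_le_mul_left _ ih
      _ ≤ 16 * (m + 1) ^ 2 * (3 * m + 1) * 16 ^ m := Nat.mul_le_mul_right _ hpoly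
      _ = (m + 1) ^ 2 * (3 * m + 1) * 16 ^ (m + 1) := by ring

/-- The largest binomial coefficient: `C(j, ⌊j/2⌋)² (j+1) ≤ 4ʲ`. [folklore] -/
theorem choose_half_sq_mul_succ_le (j : ℕ) : (j.choose (j / 2)) ^ 2 * (j + 1) ≤ 4 ^ j := by
  rcases Nat.even_or_odd' j with ⟨m, rfl | rfl⟩
  · rw [show 2 * m / 2 = m by omega, ← Nat.centralBinom_eq_two_mul_choose, pow_mul,
      show (4 : ℕ) ^ 2 = 16 by norm_num]
    calc m.centralBinom ^ 2 * (2 * m + 1) ≤ m.centralBinom ^ 2 * (3 * m + 1) :=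
          Nat.mul_le_mul_left _ (by omega)
      _ ≤ 16 ^ m := centralBinom_sq_mul_le m
  · rw [show (2 * m + 1) / 2 = m by omega]
    have h1 : (2 * m + 1).choose m * (m + 1) = (2 * m + 1) * m.centralBinom := by
      have h := Nat.add_one_mul_choose_eq (2 * m) m
      rw [Nat.choose_symm_half] at h
      rw [Nat.centralBinom_eq_two_mul_choose]
      exact h.symm
    have hpos : 0 < (m + 1) ^ 2 * (3 * m + 1) := by positivity
    refine Nat.le_of_mul_le_mul_left ?_ hpos
    have hpoly : (2 * m + 1) ^ 2 * (2 * m + 2) ≤ 4 * (m + 1) ^ 2 * (3 * m + 1) := by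
      have : 4 * (m + 1) ^ 2 * (3 * m + 1) =
          (2 * m + 1) ^ 2 * (2 * m + 2) + (2 * m + 2) * (2 * m ^ 2 + 4 * m + 1) := by ring
      rw [this]
      exact Nat.le_add_right _ _
    calc (m + 1) ^ 2 * (3 * m + 1) * ((2 * m + 1).choose m ^ 2 * (2 * m + 1 + 1))
        = ((2 * m + 1).choose m * (m + 1)) ^ 2 * (2 * m + 2) * (3 * m + 1) := by ring
      _ = ((2 * m + 1) * m.centralBinom) ^ 2 * (2 * m + 2) * (3 * m + 1) := by rw [h1]
      _ = (2 * m + 1) ^ 2 * (2 * m + 2) * (m.centralBinom ^ 2 * (3 * m + 1)) := by ring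
      _ ≤ (2 * m + 1) ^ 2 * (2 * m + 2) * 16 ^ m :=
          Nat.mul_le_mul_left _ (centralBinom_sq_mul_le m)
      _ ≤ 4 * (m + 1) ^ 2 * (3 * m + 1) * 16 ^ m := Nat.mul_le_mul_right _ hpoly
      _ = (m + 1) ^ 2 * (3 * m + 1) * 4 ^ (2 * m + 1) := by
          have e4 : (4 : ℕ) ^ (2 * m + 1) = 4 * 16 ^ m := by
            rw [pow_succ, pow_mul]
            norm_num
            ring
          rw [e4]
          ring

/-- `C(j,i)/2ʲ ≤ 1/√(j+1)`: the modal probability of `Bin(j, ½)`. [folklore] -/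
theorem choose_div_two_pow_le (j i : ℕ) :
    (j.choose i : ℝ) / 2 ^ j ≤ 1 / Real.sqrt (j + 1) := by
  have h1 : (j.choose i : ℝ) ≤ j.choose (j / 2) := by exact_mod_cast Nat.choose_le_middle i j
  have h2 : ((j.choose (j / 2) : ℝ)) ^ 2 * (j + 1) ≤ 4 ^ j := by
    exact_mod_cast choose_half_sq_mul_succ_le j
  have hsq : 0 < Real.sqrt (j + 1) := Real.sqrt_pos.2 (by positivity)
  rw [div_le_div_iff₀ (by positivity) hsq, one_mul]
  calc (j.choose i : ℝ) * Real.sqrt (j + 1) ≤ j.choose (j / 2) * Real.sqrt (j + 1) := by gcongr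
    _ ≤ 2 ^ j := by
        refine (pow_le_pow_iff_left₀ (by positivity) (by positivity) two_ne_zero).1 ?_
        rw [mul_pow, Real.sq_sqrt (by positivity), ← pow_mul, mul_comm j 2, pow_mul]
        norm_num
        exact h2

/-- The uniform distribution on the `L` negative integers `{-L, …, -1}`:
`z_L = L⁻¹ Σ_{m=-L}^{-1} δ_m`. [folklore] -/
def zStep (L : ℕ) : ℝ[ℤ] :=
  ((L : ℝ))⁻¹ • ∑ m ∈ Ico (-(L : ℤ)) 0, single m (1 : ℝ)

/-- The fair coin on `{0, L}`: `b_L = ½ (δ_L + δ_0)`. [folklore] -/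
def bStep (L : ℕ) : ℝ[ℤ] := (1 / 2 : ℝ) • (single (L : ℤ) (1 : ℝ) + 1)

/-- `z_L ≥ 0`. [folklore] -/
theorem nonneg_zStep (L : ℕ) : Nonneg (zStep L) :=
  (nonneg_sum _ fun m _ => nonneg_single m zero_le_one).smul (by positivity)

/-- `b_L ≥ 0`. [folklore] -/
theorem nonneg_bStep (L : ℕ) : Nonneg (bStep L) :=
  ((nonneg_single _ zero_le_one).add nonneg_one).smul (by positivity)

/-- `mass z_L = 1` for `L ≥ 1`. [folklore] -/
theorem mass_zStep (hL : 1 ≤ L) : mass (zStep L) = 1 := by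
  rw [zStep, mass_smul, mass_sum]
  simp only [mass_single, Finset.sum_const, nsmul_eq_mul, mul_one, Int.card_Ico]
  have : ((0 : ℤ) - -(L : ℤ)).toNat = L := by omega
  rw [this]
  exact inv_mul_cancel₀ (by positivity)

/-- **The randomisation identity**: `u_L = (2L+1)⁻¹ δ_L + (2L/(2L+1)) (z_L * b_L)` — a uniform
point of `{-L,…,L}` is `L` with probability `1/(2L+1)`, and otherwise a uniform point of
`{-L,…,-1}` plus an independent fair multiple `{0, L}` of `L`. [folklore] -/
theorem uniformStep_eq (hL : 1 ≤ L) :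
    uniformStep L = ((2 * L + 1 : ℝ))⁻¹ • single (L : ℤ) (1 : ℝ) +
      ((2 * L : ℝ) / (2 * L + 1)) • (zStep L * bStep L) := by
  have hL0 : (L : ℝ) ≠ 0 := by positivity
  have hzb : zStep L * bStep L =
      ((2 * L : ℝ))⁻¹ • ∑ m ∈ Ico (-(L : ℤ)) L, single m (1 : ℝ) := by
    rw [zStep, bStep, smul_mul_smul_comm, mul_add, mul_one, Finset.sum_mul]
    simp_rw [single_mul_single, mul_one]
    have hre : ∑ m ∈ Ico (-(L : ℤ)) 0, single (m + L) (1 : ℝ) =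
        ∑ m ∈ Ico (0 : ℤ) L, single m (1 : ℝ) := by
      refine Finset.sum_equiv (Equiv.addRight (L : ℤ)) (fun m => ?_) (fun m _ => rfl)
      simp only [Equiv.coe_addRight, Finset.mem_Ico]
      omega
    rw [hre, add_comm, ← Finset.sum_union (Finset.Ico_disjoint_Ico_consecutive (-(L : ℤ)) 0 L),
      Finset.Ico_union_Ico_eq_Ico (by omega) (by omega)]
    congr 1
    rw [mul_inv, one_div]
    ring
  rw [hzb, smul_smul]
  have hc : (2 * L : ℝ) / (2 * L + 1) * ((2 * L : ℝ))⁻¹ = ((2 * L + 1 : ℝ))⁻¹ := by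
    field_simp
  rw [hc, ← smul_add, uniformStep]
  congr 1
  rw [← Finset.Ico_union_Ico_eq_Ico (a := -(L : ℤ)) (b := L) (c := L + 1) (by omega) (by omega),
    Finset.sum_union (Finset.Ico_disjoint_Ico_consecutive _ _ _), add_comm]
  congr 1
  have : Ico (L : ℤ) (L + 1) = {(L : ℤ)} := by
    ext m
    simp only [Finset.mem_Ico, Finset.mem_singleton]
    omega
  rw [this, Finset.sum_singleton]

/-- **Equidistribution modulo `L`**: for `g ≥ 0` of mass `≤ 1`, the measure `g * z_L` gives
mass at most `1/L` to every residue class: `Σ_i (g * z_L)(w - f(i) L) ≤ 1/L` for distinct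
integers `f(i)`. [folklore] -/
theorem sum_coeff_mul_zStep_le {g : ℝ[ℤ]} (hg : Nonneg g) (hg1 : mass g ≤ 1) (hL : 1 ≤ L)
    {ι : Type*} (I : Finset ι) {f : ι → ℤ} (hf : Set.InjOn f I) (w : ℤ) :
    ∑ i ∈ I, (g * zStep L).coeff (w - f i * L) ≤ ((L : ℝ))⁻¹ := by
  classical
  have hz : ∀ v, (g * zStep L).coeff v =
      ((L : ℝ))⁻¹ * ∑ m ∈ Ico (-(L : ℤ)) 0, g.coeff (v - m) :=
    fun v => coeff_mul_smul_sum_single g _ _ v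
  simp_rw [hz]
  rw [← Finset.mul_sum]
  refine mul_le_of_le_one_right (by positivity) ?_
  rw [← Finset.sum_product']
  have hinj :
      Set.InjOn (fun p : ι × ℤ => w - f p.1 * L - p.2) ↑(I ×ˢ Ico (-(L : ℤ)) 0) := by
    rintro ⟨i, m⟩ hp ⟨i', m'⟩ hp' h
    simp only [Finset.coe_product, Set.mem_prod, Finset.mem_coe, Finset.mem_Ico] at hp hp'
    dsimp only at h
    have hL1 : (1 : ℤ) ≤ L := by exact_mod_cast hL
    have hii : f i = f i' := by
      by_contra hne
      have h1 : (1 : ℤ) ≤ |f i - f i'| := Int.one_le_abs (sub_ne_zero.2 hne)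
      have h2 : (f i - f i') * L = m' - m := by linarith
      have h3 : |m' - m| < L := by
        rw [abs_lt]
        constructor <;> omega
      rw [← h2, abs_mul, Nat.abs_cast] at h3
      nlinarith
    have hi : i = i' := hf hp.1 hp'.1 hii
    subst hi
    have hm : m = m' := by linarith
    rw [hm]
  calc ∑ p ∈ I ×ˢ Ico (-(L : ℤ)) 0, g.coeff (w - f p.1 * L - p.2)
      = ∑ c ∈ (I ×ˢ Ico (-(L : ℤ)) 0).image (fun p : ι × ℤ => w - f p.1 * L - p.2),
          g.coeff c := (Finset.sum_image hinj).symm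
    _ ≤ mass g := hg.sum_coeff_le_mass _
    _ ≤ 1 := hg1

/-- A term of the binomial expansion with `j ≥ 1` randomised factors is uniformly small:
`(z_Lʲ * b_Lʲ)(w) ≤ (1/√(j+1)) · (1/L)`. [folklore] -/
theorem coeff_zStep_pow_mul_bStep_pow_le (hL : 1 ≤ L) {j : ℕ} (hj : 1 ≤ j) (w : ℤ) :
    ((zStep L) ^ j * (bStep L) ^ j).coeff w ≤ 1 / Real.sqrt (j + 1) * ((L : ℝ))⁻¹ := by
  have hb : (bStep L) ^ j =
      (1 / 2 : ℝ) ^ j •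
        ∑ i ∈ range (j + 1), single ((i : ℤ) * L) ((j.choose i : ℕ) : ℝ) := by
    rw [bStep, smul_pow, add_pow]
    congr 1
    refine Finset.sum_congr rfl fun i _ => ?_
    rw [one_pow, mul_one, single_pow, one_pow, nsmul_eq_mul, ← nsmul_eq_mul', smul_single,
      nsmul_eq_mul, mul_one]
  have hzj : Nonneg ((zStep L) ^ j) := (nonneg_zStep L).pow j
  rw [hb, mul_smul_comm, coeff_smul, Finsupp.smul_apply, smul_eq_mul, Finset.mul_sum, coeff_sum,
    Finsupp.coe_finsetSum, Finset.sum_apply]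
  simp_rw [AddMonoidAlgebra.coeff_mul_single_apply]
  have hC : ∀ i ∈ range (j + 1),
      ((zStep L) ^ j).coeff (w + -((i : ℤ) * L)) * ((j.choose i : ℕ) : ℝ) ≤
        ((zStep L) ^ j).coeff (w + -((i : ℤ) * L)) * ((j.choose (j / 2) : ℕ) : ℝ) :=
    fun i _ => mul_le_mul_of_nonneg_left (by exact_mod_cast Nat.choose_le_middle i j) (hzj _)
  obtain ⟨k, rfl⟩ : ∃ k, j = k + 1 := ⟨j - 1, by omega⟩
  have hsumz : ∑ i ∈ range (k + 1 + 1), ((zStep L) ^ (k + 1)).coeff (w + -((i : ℤ) * L)) ≤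
      ((L : ℝ))⁻¹ := by
    rw [pow_succ]
    have := sum_coeff_mul_zStep_le ((nonneg_zStep L).pow k)
      (by rw [mass_pow, mass_zStep hL, one_pow]) hL (range (k + 1 + 1))
      (f := fun i : ℕ => (i : ℤ)) Nat.cast_injective.injOn w
    simpa only [sub_eq_add_neg] using this
  calc (1 / 2 : ℝ) ^ (k + 1) * ∑ i ∈ range (k + 1 + 1),
        ((zStep L) ^ (k + 1)).coeff (w + -((i : ℤ) * L)) * (((k + 1).choose i : ℕ) : ℝ)
      ≤ (1 / 2 : ℝ) ^ (k + 1) * ∑ i ∈ range (k + 1 + 1),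
          ((zStep L) ^ (k + 1)).coeff (w + -((i : ℤ) * L)) *
            (((k + 1).choose ((k + 1) / 2) : ℕ) : ℝ) :=
        mul_le_mul_of_nonneg_left (Finset.sum_le_sum hC) (by positivity)
    _ = (((k + 1).choose ((k + 1) / 2) : ℕ) : ℝ) / 2 ^ (k + 1) *
          ∑ i ∈ range (k + 1 + 1), ((zStep L) ^ (k + 1)).coeff (w + -((i : ℤ) * L)) := by
        rw [← Finset.sum_mul, one_div, inv_pow]
        ring
    _ ≤ 1 / Real.sqrt ((k + 1 : ℕ) + 1) * ((L : ℝ))⁻¹ :=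
        mul_le_mul (choose_div_two_pow_le _ _) hsumz (Finset.sum_nonneg fun i _ => hzj _)
          (by positivity)

/-- **`E[1/√(n-K+1)] ≤ 1/√((n+1)q)` for `K ∼ Bin(n, p)`**, `p + q = 1`: by Cauchy–Schwarz
and `Σ_k C(n,k) pᵏ qⁿ⁻ᵏ/(n-k+1) = Σ_k C(n+1,k) pᵏ qⁿ⁻ᵏ/(n+1) ≤ 1/((n+1)q)`. [folklore] -/
theorem binomial_sum_div_sqrt_le {p q : ℝ} (hp : 0 ≤ p) (hq : 0 < q) (hpq : p + q = 1)
    (n : ℕ) :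
    ∑ k ∈ range (n + 1), (n.choose k : ℝ) * p ^ k * q ^ (n - k) / Real.sqrt ((n - k : ℕ) + 1)
      ≤ 1 / Real.sqrt ((n + 1) * q) := by
  set w : ℕ → ℝ := fun k => (n.choose k : ℝ) * p ^ k * q ^ (n - k) with hw
  have hw0 : ∀ k, 0 ≤ w k := fun k => by positivity
  have hwsum : ∑ k ∈ range (n + 1), w k = 1 := by
    have h := add_pow p q n
    rw [hpq, one_pow] at h
    rw [h]
    exact Finset.sum_congr rfl fun k _ => by simp only [hw]; ring
  have hsum2 : ∑ k ∈ range (n + 1), w k / ((n - k : ℕ) + 1) ≤ 1 / ((n + 1) * q) := by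
    have hk : ∀ k ∈ range (n + 1), w k / ((n - k : ℕ) + 1) =
        ((n + 1).choose k : ℝ) * p ^ k * q ^ (n - k) / (n + 1) := by
      intro k hk
      have hkn : k ≤ n := Nat.lt_succ_iff.1 (Finset.mem_range.1 hk)
      have h := Nat.choose_mul_succ_eq n k
      have h' : (n.choose k : ℝ) * (n + 1) = ((n + 1).choose k : ℝ) * ((n - k : ℕ) + 1) := by
        have e : (n + 1 - k : ℕ) = (n - k) + 1 := by omega
        rw [e] at h
        exact_mod_cast h
      simp only [hw]
      rw [div_eq_div_iff (by positivity) (by positivity)]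
      calc (n.choose k : ℝ) * p ^ k * q ^ (n - k) * (n + 1)
          = (n.choose k : ℝ) * (n + 1) * p ^ k * q ^ (n - k) := by ring
        _ = ((n + 1).choose k : ℝ) * ((n - k : ℕ) + 1) * p ^ k * q ^ (n - k) := by rw [h']
        _ = _ := by ring
    rw [Finset.sum_congr rfl hk, ← Finset.sum_div]
    have hq' :
        q * ∑ k ∈ range (n + 1), ((n + 1).choose k : ℝ) * p ^ k * q ^ (n - k) ≤ 1 := by
      calc q * ∑ k ∈ range (n + 1), ((n + 1).choose k : ℝ) * p ^ k * q ^ (n - k)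
          = ∑ k ∈ range (n + 1), ((n + 1).choose k : ℝ) * p ^ k * q ^ (n + 1 - k) := by
            rw [Finset.mul_sum]
            refine Finset.sum_congr rfl fun k hk => ?_
            have hkn : k ≤ n := Nat.lt_succ_iff.1 (Finset.mem_range.1 hk)
            rw [show n + 1 - k = (n - k) + 1 by omega, pow_succ]
            ring
        _ ≤ ∑ k ∈ range (n + 1 + 1), ((n + 1).choose k : ℝ) * p ^ k * q ^ (n + 1 - k) := by
            rw [Finset.sum_range_succ _ (n + 1)]
            have : 0 ≤ ((n + 1).choose (n + 1) : ℝ) * p ^ (n + 1) * q ^ (n + 1 - (n + 1)) := by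
              positivity
            linarith
        _ = (p + q) ^ (n + 1) := by
            rw [add_pow]
            exact Finset.sum_congr rfl fun k _ => by ring
        _ = 1 := by rw [hpq, one_pow]
    rw [div_le_div_iff₀ (by positivity) (by positivity), one_mul]
    calc (∑ k ∈ range (n + 1), ((n + 1).choose k : ℝ) * p ^ k * q ^ (n - k)) * ((n + 1) * q)
        = (n + 1) *
            (q * ∑ k ∈ range (n + 1), ((n + 1).choose k : ℝ) * p ^ k * q ^ (n - k)) := by
          ring
      _ ≤ (n + 1) * 1 := mul_le_mul_of_nonneg_left hq' (by positivity)
      _ = n + 1 := mul_one _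
  have hCS := Finset.sum_sq_le_sum_mul_sum_of_sq_le_mul (range (n + 1))
    (r := fun k => w k / Real.sqrt ((n - k : ℕ) + 1)) (f := w)
    (g := fun k => w k / ((n - k : ℕ) + 1)) (fun k _ => hw0 k) (fun k _ => by positivity)
    (fun k _ => by rw [div_pow, Real.sq_sqrt (by positivity)]; exact le_of_eq (by ring))
  have hS0 : 0 ≤ ∑ k ∈ range (n + 1), w k / Real.sqrt ((n - k : ℕ) + 1) :=
    Finset.sum_nonneg fun k _ => by positivity
  have hS2 :
      (∑ k ∈ range (n + 1), w k / Real.sqrt ((n - k : ℕ) + 1)) ^ 2 ≤ 1 / ((n + 1) * q) := by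
    calc _ ≤ (∑ k ∈ range (n + 1), w k) * ∑ k ∈ range (n + 1), w k / ((n - k : ℕ) + 1) :=
          hCS
      _ ≤ 1 * (1 / ((n + 1) * q)) := by
          rw [hwsum]
          exact mul_le_mul_of_nonneg_left hsum2 zero_le_one
      _ = _ := one_mul _
  have hfin : ∑ k ∈ range (n + 1), w k / Real.sqrt ((n - k : ℕ) + 1) ≤
      Real.sqrt (1 / ((n + 1) * q)) := (Real.le_sqrt hS0 (by positivity)).2 hS2
  rwa [Real.sqrt_div' _ (by positivity), Real.sqrt_one] at hfin

/-- **The local bound** for the uniform-step walk, uniformly in `L ≥ 1` and `n ≥ 1`: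
`P(S_n = y) = u_Lⁿ(y) ≤ 2/(L√n)` for all `y ∈ ℤ`. [folklore] -/
theorem coeff_uniformStep_pow_le_local (hL : 1 ≤ L) {n : ℕ} (hn : 1 ≤ n) (y : ℤ) :
    ((uniformStep L) ^ n).coeff y ≤ 2 / (L * Real.sqrt n) := by
  have hL' : (1 : ℝ) ≤ L := by exact_mod_cast hL
  have hn' : (1 : ℝ) ≤ n := by exact_mod_cast hn
  set p : ℝ := ((2 * L + 1 : ℝ))⁻¹ with hp
  set q : ℝ := (2 * L : ℝ) / (2 * L + 1) with hq
  have hp0 : 0 ≤ p := by positivity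
  have hq0 : 0 < q := by positivity
  have hpq : p + q = 1 := by
    rw [hp, hq]
    field_simp
    ring
  have hq23 : 2 / 3 ≤ q := by
    rw [hq, div_le_div_iff₀ (by norm_num) (by positivity)]
    nlinarith
  -- the binomial expansion of `uⁿ = (p δ_L + q z*b)ⁿ`, coefficientwise
  have hexp : ((uniformStep L) ^ n).coeff y = ∑ k ∈ range (n + 1),
      (n.choose k : ℝ) * p ^ k * q ^ (n - k) *
        ((zStep L) ^ (n - k) * (bStep L) ^ (n - k)).coeff (y - k * L) := by
    rw [uniformStep_eq hL, add_pow, coeff_sum, Finsupp.coe_finsetSum, Finset.sum_apply]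
    refine Finset.sum_congr rfl fun k _ => ?_
    rw [smul_pow, single_pow, one_pow, smul_pow, mul_pow, nsmul_eq_mul, ← nsmul_eq_mul',
      coeff_smul, Finsupp.smul_apply, nsmul_eq_mul, smul_mul_smul_comm, coeff_smul,
      Finsupp.smul_apply, smul_eq_mul, AddMonoidAlgebra.coeff_single_mul_apply, one_mul,
      neg_add_eq_sub]
    ring
  -- the last term (`k = n`, no randomised factor) is at most `pⁿ`
  have hlast : (n.choose n : ℝ) * p ^ n * q ^ (n - n) *
      ((zStep L) ^ (n - n) * (bStep L) ^ (n - n)).coeff (y - n * L) ≤ p ^ n := by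
    rw [Nat.choose_self, Nat.sub_self, pow_zero, pow_zero, pow_zero, mul_one, Nat.cast_one,
      one_mul, mul_one]
    have h1 : (1 : ℝ[ℤ]).coeff (y - n * L) ≤ 1 :=
      (nonneg_one.coeff_le_mass _).trans mass_one.le
    exact mul_le_of_le_one_right (by positivity) h1
  -- the other terms carry the factor `(1/√(n-k+1)) L⁻¹`
  have hrest : ∑ k ∈ range n, (n.choose k : ℝ) * p ^ k * q ^ (n - k) *
      ((zStep L) ^ (n - k) * (bStep L) ^ (n - k)).coeff (y - k * L) ≤
      ∑ k ∈ range n, (n.choose k : ℝ) * p ^ k * q ^ (n - k) / Real.sqrt ((n - k : ℕ) + 1) *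
        ((L : ℝ))⁻¹ := by
    refine Finset.sum_le_sum fun k hk => ?_
    have hkn : k < n := Finset.mem_range.1 hk
    have hW := coeff_zStep_pow_mul_bStep_pow_le hL (j := n - k) (by omega) (y - k * L)
    calc (n.choose k : ℝ) * p ^ k * q ^ (n - k) *
          ((zStep L) ^ (n - k) * (bStep L) ^ (n - k)).coeff (y - k * L)
        ≤ (n.choose k : ℝ) * p ^ k * q ^ (n - k) *
            (1 / Real.sqrt ((n - k : ℕ) + 1) * ((L : ℝ))⁻¹) :=
          mul_le_mul_of_nonneg_left hW (by positivity)
      _ = _ := by ring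
  have hmono :
      ∑ k ∈ range n, (n.choose k : ℝ) * p ^ k * q ^ (n - k) / Real.sqrt ((n - k : ℕ) + 1) ≤
        ∑ k ∈ range (n + 1),
          (n.choose k : ℝ) * p ^ k * q ^ (n - k) / Real.sqrt ((n - k : ℕ) + 1) := by
    rw [Finset.sum_range_succ]
    have : 0 ≤ (n.choose n : ℝ) * p ^ n * q ^ (n - n) / Real.sqrt ((n - n : ℕ) + 1) := by
      positivity
    linarith
  have hB := binomial_sum_div_sqrt_le hp0 hq0 hpq n
  -- numerics: `1/√((n+1)q) ≤ (3/2)/√n` and `pⁿ ≤ (1/2)/(L√n)`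
  have hsn : 0 < Real.sqrt n := Real.sqrt_pos.2 (by positivity)
  have hnum1 : 1 / Real.sqrt ((n + 1) * q) ≤ (3 / 2) / Real.sqrt n := by
    rw [div_le_div_iff₀ (Real.sqrt_pos.2 (by positivity)) hsn, one_mul]
    have h94 : Real.sqrt (9 / 4 : ℝ) = 3 / 2 := by
      rw [show (9 / 4 : ℝ) = (3 / 2) ^ 2 by norm_num, Real.sqrt_sq (by norm_num)]
    rw [← h94, ← Real.sqrt_mul (by norm_num)]
    exact Real.sqrt_le_sqrt (by nlinarith)
  have hnum2 : p ^ n ≤ (1 / 2) / (L * Real.sqrt n) := by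
    obtain ⟨m, rfl⟩ : ∃ m, n = m + 1 := ⟨n - 1, by omega⟩
    have hp3 : p ≤ 1 / 3 := by
      rw [hp, inv_eq_one_div, div_le_div_iff₀ (by positivity) (by norm_num)]
      nlinarith
    have hp2L : p ≤ 1 / (2 * L) := by
      rw [hp, inv_eq_one_div, div_le_div_iff₀ (by positivity) (by positivity)]
      nlinarith
    have hpow : p ^ m ≤ 1 / (m + 1 : ℝ) := by
      calc p ^ m ≤ (1 / 3 : ℝ) ^ m := pow_le_pow_left₀ hp0 hp3 m
        _ = 1 / 3 ^ m := by rw [div_pow, one_pow]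
        _ ≤ 1 / (m + 1 : ℝ) := by
            refine div_le_div_of_nonneg_left zero_le_one (by positivity) ?_
            exact_mod_cast Nat.succ_le_of_lt (Nat.lt_pow_self (by norm_num : 1 < 3))
    have hsq : Real.sqrt (m + 1 : ℝ) ≤ (m + 1 : ℝ) := by
      calc Real.sqrt (m + 1 : ℝ) ≤ Real.sqrt ((m + 1 : ℝ) ^ 2) :=
            Real.sqrt_le_sqrt (by nlinarith)
        _ = m + 1 := Real.sqrt_sq (by positivity)
    have h1 : (1 : ℝ) / (m + 1) ≤ 1 / Real.sqrt (m + 1 : ℝ) :=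
      div_le_div_of_nonneg_left zero_le_one (Real.sqrt_pos.2 (by positivity)) hsq
    rw [pow_succ]
    calc p ^ m * p ≤ (1 / (m + 1 : ℝ)) * (1 / (2 * L)) :=
          mul_le_mul hpow hp2L hp0 (by positivity)
      _ ≤ (1 / Real.sqrt (m + 1 : ℝ)) * (1 / (2 * L)) :=
          mul_le_mul_of_nonneg_right h1 (by positivity)
      _ = (1 / 2) / (L * Real.sqrt ((m + 1 : ℕ) : ℝ)) := by
          push_cast
          ring
  rw [hexp, Finset.sum_range_succ]
  calc _ ≤ (∑ k ∈ range n,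
          (n.choose k : ℝ) * p ^ k * q ^ (n - k) / Real.sqrt ((n - k : ℕ) + 1) * ((L : ℝ))⁻¹) +
        p ^ n := add_le_add hrest hlast
    _ = (∑ k ∈ range n,
          (n.choose k : ℝ) * p ^ k * q ^ (n - k) / Real.sqrt ((n - k : ℕ) + 1)) * ((L : ℝ))⁻¹ +
        p ^ n := by rw [Finset.sum_mul]
    _ ≤ (1 / Real.sqrt ((n + 1) * q)) * ((L : ℝ))⁻¹ + (1 / 2) / (L * Real.sqrt n) :=
        add_le_add (mul_le_mul_of_nonneg_right (hmono.trans hB) (by positivity)) hnum2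
    _ ≤ (3 / 2) / Real.sqrt n * ((L : ℝ))⁻¹ + (1 / 2) / (L * Real.sqrt n) := by gcongr
    _ = 2 / (L * Real.sqrt n) := by
        field_simp
        ring


/-! ## The pointwise Gaussian bound -/

/-- **Splitting a convolution by displacement**: for `a, b ≥ 0` with `a ≤ A`, `b ≤ B`,
`(a * b)(y) ≤ A · b({|w| ≥ |y|/2}) + B · a({|v| ≥ |y|/2})` (one of the two summands of
`y = v + w` has modulus at least `|y|/2`). [folklore] -/
theorem coeff_mul_le_split {a b : ℝ[ℤ]} (ha : Nonneg a) (hb : Nonneg b) {A B : ℝ}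
    (hA : ∀ m, a.coeff m ≤ A) (hB : ∀ m, b.coeff m ≤ B) (hB0 : 0 ≤ B) (y : ℤ) :
    (a * b).coeff y ≤
      A * (∑ w ∈ b.coeff.support with |(y : ℝ)| / 2 ≤ |((w : ℤ) : ℝ)|, b.coeff w) +
        B * (∑ v ∈ a.coeff.support with |(y : ℝ)| / 2 ≤ |((v : ℤ) : ℝ)|, a.coeff v) := by
  classical
  set P : ℤ → Prop := fun w => |(y : ℝ)| / 2 ≤ |((w : ℤ) : ℝ)| with hP
  rw [coeff_mul_eq_sum, ← Finset.sum_filter_add_sum_filter_not b.coeff.support P]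
  refine add_le_add ?_ ?_
  · rw [Finset.mul_sum]
    exact Finset.sum_le_sum fun w _ => mul_le_mul_of_nonneg_right (hA _) (hb w)
  · calc ∑ w ∈ b.coeff.support with ¬P w, a.coeff (y - w) * b.coeff w
        ≤ ∑ w ∈ b.coeff.support with ¬P w, a.coeff (y - w) * B :=
          Finset.sum_le_sum fun w _ => mul_le_mul_of_nonneg_left (hB w) (ha _)
      _ = B * ∑ w ∈ b.coeff.support with ¬P w, a.coeff (y - w) := by
          rw [← Finset.sum_mul, mul_comm]
      _ ≤ B * ∑ v ∈ a.coeff.support with P v, a.coeff v := by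
          refine mul_le_mul_of_nonneg_left ?_ hB0
          have hinj : Set.InjOn (fun w : ℤ => y - w)
              ↑(b.coeff.support.filter fun w : ℤ => ¬P w) :=
            fun w _ w' _ h => by simpa using h
          rw [← Finset.sum_image hinj]
          refine ha.sum_coeff_le_sum_coeff fun v hv hvs => ?_
          rw [Finset.mem_image] at hv
          obtain ⟨w, hw, rfl⟩ := hv
          rw [Finset.mem_filter] at hw ⊢
          refine ⟨hvs, ?_⟩
          have hw2 : |((w : ℤ) : ℝ)| < |(y : ℝ)| / 2 := lt_of_not_ge hw.2
          have h3 := abs_sub_abs_le_abs_sub (y : ℝ) w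
          show |(y : ℝ)| / 2 ≤ |(((y - w : ℤ)) : ℝ)|
          push_cast
          linarith

/-- The Gaussian bound at even times: `u_L^{2m}(y) ≤ (8/(L√m)) exp(-y²/(8mL²))`
(`L, m ≥ 1`), from the local bound for one factor `uᵐ` and the tail bound for the other.
[folklore] -/
theorem coeff_uniformStep_pow_two_mul_le (hL : 1 ≤ L) {m : ℕ} (hm : 1 ≤ m) (y : ℤ) :
    ((uniformStep L) ^ (2 * m)).coeff y ≤
      8 / (L * Real.sqrt m) * Real.exp (-((y : ℝ) ^ 2 / (8 * m * L ^ 2))) := by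
  have hL' : (0 : ℝ) < L := by exact_mod_cast hL
  have hm' : (0 : ℝ) < m := by exact_mod_cast hm
  set a := (uniformStep L) ^ m with ha_def
  have ha : Nonneg a := (nonneg_uniformStep L).pow m
  have hA : ∀ v, a.coeff v ≤ 2 / (L * Real.sqrt m) := coeff_uniformStep_pow_le_local hL hm
  have hA0 : 0 ≤ 2 / (L * Real.sqrt m) := by positivity
  have htail : ∑ v ∈ a.coeff.support with |(y : ℝ)| / 2 ≤ |((v : ℤ) : ℝ)|, a.coeff v ≤
      2 * Real.exp (-((|(y : ℝ)| / 2) ^ 2 / (2 * m * L ^ 2))) :=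
    tail_uniformStep_pow_le hL hm (by positivity)
  rw [two_mul, pow_add]
  set tail := ∑ v ∈ a.coeff.support with |(y : ℝ)| / 2 ≤ |((v : ℤ) : ℝ)|, a.coeff v
  calc (a * a).coeff y ≤ 2 / (L * Real.sqrt m) * tail + 2 / (L * Real.sqrt m) * tail :=
        coeff_mul_le_split ha ha hA hA hA0 y
    _ = 2 * (2 / (L * Real.sqrt m) * tail) := by ring
    _ ≤ 2 * (2 / (L * Real.sqrt m) *
          (2 * Real.exp (-((|(y : ℝ)| / 2) ^ 2 / (2 * m * L ^ 2))))) := by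
        gcongr
    _ = 8 / (L * Real.sqrt m) * Real.exp (-((|(y : ℝ)| / 2) ^ 2 / (2 * m * L ^ 2))) := by ring
    _ = 8 / (L * Real.sqrt m) * Real.exp (-((y : ℝ) ^ 2 / (8 * m * L ^ 2))) := by
        congr 3
        rw [div_pow, sq_abs]
        ring

/-- The Gaussian bound at odd times `2m+1 ≥ 3`: one more uniform step costs at most the
factor `e^{1/8}` and halves the rate: `u_L^{2m+1}(y) ≤ (8e^{1/8}/(L√m)) exp(-y²/(16mL²))`.
[folklore] -/
theorem coeff_uniformStep_pow_two_mul_add_one_le (hL : 1 ≤ L) {m : ℕ} (hm : 1 ≤ m) (y : ℤ) :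
    ((uniformStep L) ^ (2 * m + 1)).coeff y ≤
      8 * Real.exp (1 / 8) / (L * Real.sqrt m) *
        Real.exp (-((y : ℝ) ^ 2 / (16 * m * L ^ 2))) := by
  have hL' : (0 : ℝ) < L := by exact_mod_cast hL
  have hm' : (1 : ℝ) ≤ m := by exact_mod_cast hm
  rw [pow_succ, coeff_mul_uniformStep]
  set S := Ico (-(L : ℤ)) (L + 1) with hS
  have hbd : ∀ v ∈ S, ((uniformStep L) ^ (2 * m)).coeff (y - v) ≤
      8 * Real.exp (1 / 8) / (L * Real.sqrt m) *
        Real.exp (-((y : ℝ) ^ 2 / (16 * m * L ^ 2))) := by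
    intro v hv
    have hvL : ((v : ℤ) : ℝ) ^ 2 ≤ (L : ℝ) ^ 2 := by
      rw [hS, Finset.mem_Ico] at hv
      have h1 : (-(L : ℝ)) ≤ v := by exact_mod_cast hv.1
      have h2 : (v : ℝ) ≤ L := by exact_mod_cast (by omega : v ≤ (L : ℤ))
      nlinarith
    refine (coeff_uniformStep_pow_two_mul_le hL hm (y - v)).trans ?_
    have key : -((((y - v : ℤ)) : ℝ) ^ 2 / (8 * m * L ^ 2)) ≤
        1 / 8 + -((y : ℝ) ^ 2 / (16 * m * L ^ 2)) := by
      push_cast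
      have h1 : (y : ℝ) ^ 2 / 2 - (v : ℝ) ^ 2 ≤ ((y : ℝ) - v) ^ 2 := by
        nlinarith [sq_nonneg ((y : ℝ) - 2 * v)]
      have h3 :
          ((y : ℝ) ^ 2 / 2 - L ^ 2) / (8 * m * L ^ 2) ≤ ((y : ℝ) - v) ^ 2 / (8 * m * L ^ 2) :=
        div_le_div_of_nonneg_right (by linarith) (by positivity)
      have h4 : ((y : ℝ) ^ 2 / 2 - L ^ 2) / (8 * m * L ^ 2) =
          (y : ℝ) ^ 2 / (16 * m * L ^ 2) - 1 / (8 * m) := by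
        field_simp
        ring
      have h5 : (1 : ℝ) / (8 * m) ≤ 1 / 8 :=
        div_le_div_of_nonneg_left zero_le_one (by norm_num) (by nlinarith)
      linarith
    calc 8 / (L * Real.sqrt m) * Real.exp (-((((y - v : ℤ)) : ℝ) ^ 2 / (8 * m * L ^ 2)))
        ≤ 8 / (L * Real.sqrt m) * Real.exp (1 / 8 + -((y : ℝ) ^ 2 / (16 * m * L ^ 2))) :=
          mul_le_mul_of_nonneg_left (Real.exp_le_exp.2 key) (by positivity)
      _ = _ := by
          rw [Real.exp_add]
          ring
  have hcard : (S.card : ℝ) = 2 * L + 1 := by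
    rw [hS, Int.card_Ico]
    have : ((L : ℤ) + 1 - -(L : ℤ)).toNat = 2 * L + 1 := by omega
    rw [this]
    push_cast
    ring
  have hpos : (0 : ℝ) < 2 * L + 1 := by positivity
  calc ((2 * L + 1 : ℝ))⁻¹ * ∑ v ∈ S, ((uniformStep L) ^ (2 * m)).coeff (y - v)
      ≤ ((2 * L + 1 : ℝ))⁻¹ * ∑ _v ∈ S, 8 * Real.exp (1 / 8) / (L * Real.sqrt m) *
          Real.exp (-((y : ℝ) ^ 2 / (16 * m * L ^ 2))) :=
        mul_le_mul_of_nonneg_left (Finset.sum_le_sum hbd) (by positivity)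
    _ = _ := by
        rw [Finset.sum_const, nsmul_eq_mul, hcard, ← mul_assoc, inv_mul_cancel₀ hpos.ne',
          one_mul]

/-- **The Gaussian upper bound for the uniform-step walk**, uniformly in the range: for
`L ≥ 1`, `n ≥ 1` and all `y ∈ ℤ`,
`P(S_n = y) = u_Lⁿ(y) ≤ (20/(L√n)) exp(-y²/(8nL²))`. [folklore] -/
theorem coeff_uniformStep_pow_le_gauss (hL : 1 ≤ L) {n : ℕ} (hn : 1 ≤ n) (y : ℤ) :
    ((uniformStep L) ^ n).coeff y ≤
      20 / (L * Real.sqrt n) * Real.exp (-((y : ℝ) ^ 2 / (8 * n * L ^ 2))) := by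
  have hL' : (0 : ℝ) < L := by exact_mod_cast hL
  have hy2 : 0 ≤ (y : ℝ) ^ 2 := sq_nonneg _
  rcases Nat.even_or_odd' n with ⟨m, rfl | rfl⟩
  · -- even `n = 2m`
    have hm : 1 ≤ m := by omega
    have hm' : (0 : ℝ) < m := by exact_mod_cast hm
    refine (coeff_uniformStep_pow_two_mul_le hL hm y).trans ?_
    have h1 : 8 / (L * Real.sqrt m) ≤ 20 / (L * Real.sqrt ((2 * m : ℕ) : ℝ)) := by
      have hs2 : Real.sqrt ((2 * m : ℕ) : ℝ) = Real.sqrt 2 * Real.sqrt m := by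
        push_cast
        exact Real.sqrt_mul (by norm_num) _
      have hsqrt2 : Real.sqrt 2 ≤ 2 := by
        rw [show (2 : ℝ) = Real.sqrt (2 ^ 2) by rw [Real.sqrt_sq (by norm_num)]]
        exact Real.sqrt_le_sqrt (by norm_num)
      rw [hs2, div_le_div_iff₀ (by positivity) (by positivity)]
      have : 0 < L * Real.sqrt m := by positivity
      nlinarith
    have h2 :
        -((y : ℝ) ^ 2 / (8 * m * L ^ 2)) ≤ -((y : ℝ) ^ 2 / (8 * ((2 * m : ℕ) : ℝ) * L ^ 2)) := by
      push_cast
      rw [neg_le_neg_iff]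
      exact div_le_div_of_nonneg_left hy2 (by positivity) (by nlinarith)
    exact mul_le_mul h1 (Real.exp_le_exp.2 h2) (Real.exp_nonneg _) (by positivity)
  · rcases Nat.eq_zero_or_pos m with rfl | hm
    · -- `n = 1`
      simp only [Nat.mul_zero, zero_add, pow_one, Nat.cast_one, Real.sqrt_one, mul_one]
      rw [coeff_uniformStep]
      split_ifs with h
      · have hyL : (y : ℝ) ^ 2 ≤ (L : ℝ) ^ 2 := by
          have h' : |(y : ℝ)| ≤ L := by
            rw [← Int.cast_abs]
            exact_mod_cast h
          have := abs_nonneg (y : ℝ)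
          nlinarith [sq_abs (y : ℝ)]
        have hexp : (7 : ℝ) / 8 ≤ Real.exp (-((y : ℝ) ^ 2 / (8 * L ^ 2))) := by
          calc (7 : ℝ) / 8 = 1 - 1 / 8 := by norm_num
            _ ≤ Real.exp (-(1 / 8)) := Real.one_sub_le_exp_neg _
            _ ≤ Real.exp (-((y : ℝ) ^ 2 / (8 * L ^ 2))) := by
                refine Real.exp_le_exp.2 (neg_le_neg ?_)
                rw [div_le_iff₀ (by positivity)]
                nlinarith
        calc ((2 * L + 1 : ℝ))⁻¹ ≤ 1 / L := by
              rw [inv_eq_one_div, div_le_div_iff₀ (by positivity) hL']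
              nlinarith
          _ ≤ 20 / L * (7 / 8) := by
              rw [div_mul_eq_mul_div, div_le_div_iff₀ hL' hL']
              nlinarith
          _ ≤ 20 / L * Real.exp (-((y : ℝ) ^ 2 / (8 * L ^ 2))) :=
              mul_le_mul_of_nonneg_left hexp (by positivity)
      · positivity
    · -- odd `n = 2m+1 ≥ 3`
      have hm' : (1 : ℝ) ≤ m := by exact_mod_cast hm
      refine (coeff_uniformStep_pow_two_mul_add_one_le hL hm y).trans ?_
      have he : Real.exp (1 / 8) ≤ 8 / 7 := by
        have := Real.exp_bound_div_one_sub_of_interval (x := 1 / 8) (by norm_num) (by norm_num)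
        calc Real.exp (1 / 8) ≤ 1 / (1 - 1 / 8) := this
          _ = 8 / 7 := by norm_num
      have h1 : 8 * Real.exp (1 / 8) / (L * Real.sqrt m) ≤
          20 / (L * Real.sqrt ((2 * m + 1 : ℕ) : ℝ)) := by
        have hs : Real.sqrt ((2 * m + 1 : ℕ) : ℝ) ≤ 2 * Real.sqrt m := by
          rw [show (2 : ℝ) * Real.sqrt m = Real.sqrt (2 ^ 2 * m) by
            rw [Real.sqrt_mul (by norm_num), Real.sqrt_sq (by norm_num)]]
          push_cast
          exact Real.sqrt_le_sqrt (by nlinarith)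
        have hsm : 0 < Real.sqrt m := Real.sqrt_pos.2 (by positivity)
        rw [div_le_div_iff₀ (by positivity) (by positivity)]
        calc 8 * Real.exp (1 / 8) * (L * Real.sqrt ((2 * m + 1 : ℕ) : ℝ))
            ≤ 8 * (8 / 7) * (L * (2 * Real.sqrt m)) := by gcongr
          _ ≤ 20 * (L * Real.sqrt m) := by nlinarith [mul_pos hL' hsm]
      have h2 : -((y : ℝ) ^ 2 / (16 * m * L ^ 2)) ≤
          -((y : ℝ) ^ 2 / (8 * ((2 * m + 1 : ℕ) : ℝ) * L ^ 2)) := by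
        push_cast
        rw [neg_le_neg_iff]
        exact div_le_div_of_nonneg_left hy2 (by positivity) (by nlinarith)
      exact mul_le_mul h1 (Real.exp_le_exp.2 h2) (Real.exp_nonneg _) (by positivity)

end UniformStep

end Literature.Probability.LatticeModels
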